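import Mathlib
import HarnessLib
import Summits.HubbardSuperconductivity.HubbardSuperconductivity.Theorems.KLProgrammeKLRegimeCountertermJacksonRemainderCertAnFit
import Summits.HubbardSuperconductivity.HubbardSuperconductivity.Theorems.KLProgrammeKLRegimeCountertermJacksonRemainderCertAnFitDefs
import Summits.HubbardSuperconductivity.HubbardSuperconductivity.Theorems.KLProgrammeKLRegimeCountertermJacksonRemainderCertAnKlEng
import Summits.HubbardSuperconductivity.HubbardSuperconductivity.Theorems.KLProgrammeKLRegimeCountertermJacksonRemainderReadResidueC1IH
import Summits.HubbardSuperconductivity.HubbardSuperconductivity.Theorems.KLProgrammeKLRegimeTwoLegCurvatureConstsJetC2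

/-!
# (C1) ANALYTIC CERTIFICATE at deep scales — «(C1)-AN-FIT»: THE (C1) BRACKET IN `readResidue_flow_hP`'s CURRENCY, ONE CALL, EVERY `n ≥ 5`

Cell `gate-hubbard-kl`, seat hubbard-kl-k3c3-p3 (g13), `--supports stmt-HubbardSuperconductivity-20437` (stub (C) `stub_twoLeg_curvature` of
`KLRegimeEngineV17F2`); successor item (w11) «(C1)-AN-FIT» of the seat's HANDOFF § gen 12; pen plan g21 l.4315 (4) «tables n ≤ 4 / analytic n ≥ 5».

**`readResidueC1_hJ_analytic_klEng`** — at stub (C)'s binders (`R.WF`, `0 < c ≤ klEngC₃6 P R`, `μ ∈ klWindowC`, `0 < U ≤ klEngU₀9 P R c`,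
`klBetaMin ≤ β ≤ e^{c/U²}`), the regime `IsKLRegime U c (−(n+1))`, the new flow frame admissible (`FrameOK R U (nScales β) μ K_{n+1}`), the history
`FlowPieceJetsAt … m` (`m ≤ n`), the window certificate `KlwjCertA` (the one named numerical hypothesis of the analytic branch, as in c4a-1's
`hJjet_cert`), a reading scale `n ≥ 5`, and the induction hypothesis `TwoLegReadJetBound L M cc cc' β U μ K_n n` with nonnegative tables:
the Jackson bracket `J(θ) = ν_n(K_n)(θ) − (klFlowPiece n).eval (k_F^{K_{n+1}} θ)` is `C⁴` and
  `∀ k ≤ 4, ∀ θ, |∂ᵏJ(θ)| ≤ curveJetBar (klC1AnFit cc) (klC1AnFit' cc cc') U k (n+1)`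
— EXACTLY the pair `(hJdiff, hJ)` of `readResidue_flow_hP` (…FlowReadResidueSplit, the (C) doors' currency contract), with the numeric transfer
matrix `klC1AnFit` (…CertAnFitDefs): `eJ 4 = 0.0075·cc 1 + 1.1·10⁻⁸·cc 2 + 2.5·10⁻⁷·cc 3 + 0.12502·cc 4`, `eJ 3 = 0.00098·cc 1 + 4.7·10⁻⁷·cc 2 +
4.56·10⁻⁵·cc 3 + 0.00295·cc 4`, `eJ 2 = 6.1·10⁻⁶·cc 1 + 1.18·10⁻⁴·cc 2 + 0.0118·cc 3`, `eJ 1 = 2.36·10⁻⁴·cc 1 + 0.0472·cc 2`, `eJ 0 = 0`;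
`eJ' k = (same matrix)·cc'` plus the value row `eJ' 0 = 0.189·(cc 1 + cc' 1)`.
Chain: `readResidueC1_jets_analytic_klEng` (…CertAnKlEng: `T.bound`/`T.boundNR`/value for the analytic table at the flow frame's size table) ∘
k3c3-p1's `ihSizes_of_twoLegReadJetBound` (`a 0 = (π/2)·a 1`, …ReadResidueC1IH) ∘ `klC1TableAn_bound_*_le` / `_boundNR_four_le` / `_value_le`
(…CertAnFit) with `A₃ = (Gfr₃/3)U²4^{n+1}`, `A₄ = (Gfr₄/15)U²16^{n+1}`, whose `n`-free smallness `A₃·4⁻ⁿ = (4/3)Gfr₃U² ≤ 2⁻¹²⁶`,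
`A₄·16⁻ⁿ = (16/15)Gfr₄U² ≤ 2⁻¹²⁶` is k3c3-p1's `gfr_mul_le_of_le_klEngU₀4` (`Gfr_j·U ≤ 2⁻¹²⁷`).  The table branch `n + 1 ≤ 5` stays
k3c3-p1's `readResidueC1_jets_of_twoLegReadJetBound_klEng` (kit tables).
Assembly only; the window certificate stays a hypothesis; nothing here asserts stub (C), K3 or superconductivity.
-/

noncomputable section

namespace Summit.HubbardSuperconductivity.HubbardSuperconductivity.Theorems.KLRegimeSplit

set_option linter.dupNamespace false -- summit = problem name (single-conjunct summit), D-0017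

open Real
open Literature.MathematicalPhysics.QuantumLattice Literature.Probability.LatticeModels
open Summit.HubbardSuperconductivity.HubbardSuperconductivity.Theorems.PerturbedFermiCurve
open Summit.HubbardSuperconductivity.HubbardSuperconductivity.Theorems.EngineV8
open Summit.HubbardSuperconductivity.HubbardSuperconductivity.Theorems.DispersionFlow

/-! ## §1 The output tables are `curveJetBar_of_one_le` expansions of `klC1AnFit` -/

section Currency

variable (cc cc' : ℕ → ℝ) (U : ℝ) (n : ℕ)

/-- Row `0` of the output in `…CertAnFit`'s written-out form. -/
theorem curveJetBar_klC1AnFit_zero : curveJetBar (klC1AnFit cc) (klC1AnFit' cc cc') U 0 (n + 1) =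
    (0 + 0.189 * (cc 1 + cc' 1) * |U|) * |U| * (4 : ℝ) ^ ((((0 : ℕ) : ℤ) - 2) * ((n + 1 : ℕ) : ℤ)) := by
  rw [curveJetBar_apply, klC1AnFit_zero, klC1AnFit'_zero]
  simp only [uPow, if_true]

/-- Row `1`. -/
theorem curveJetBar_klC1AnFit_one : curveJetBar (klC1AnFit cc) (klC1AnFit' cc cc') U 1 (n + 1) =
    (0.000236 * (cc 1 + cc' 1 * |U|) + 0.0472 * (cc 2 + cc' 2 * |U|)) * U ^ 2 * (4 : ℝ) ^ ((((1 : ℕ) : ℤ) - 2) * ((n + 1 : ℕ) : ℤ)) := by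
  rw [curveJetBar_of_one_le (show 1 ≤ 1 by norm_num), klC1AnFit'_of_ne_zero cc cc' one_ne_zero, klC1AnFit_one, klC1AnFit_one]
  ring

/-- Row `2`. -/
theorem curveJetBar_klC1AnFit_two : curveJetBar (klC1AnFit cc) (klC1AnFit' cc cc') U 2 (n + 1) =
    (0.0000061 * (cc 1 + cc' 1 * |U|) + 0.000118 * (cc 2 + cc' 2 * |U|) + 0.0118 * (cc 3 + cc' 3 * |U|)) * U ^ 2 *
      (4 : ℝ) ^ ((((2 : ℕ) : ℤ) - 2) * ((n + 1 : ℕ) : ℤ)) := by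
  rw [curveJetBar_of_one_le (show 1 ≤ 2 by norm_num), klC1AnFit'_of_ne_zero cc cc' (by norm_num), klC1AnFit_two, klC1AnFit_two]
  ring

/-- Row `3`. -/
theorem curveJetBar_klC1AnFit_three : curveJetBar (klC1AnFit cc) (klC1AnFit' cc cc') U 3 (n + 1) =
    (0.00098 * (cc 1 + cc' 1 * |U|) + 0.00000047 * (cc 2 + cc' 2 * |U|) + 0.0000456 * (cc 3 + cc' 3 * |U|) + 0.00295 * (cc 4 + cc' 4 * |U|)) *
      U ^ 2 * (4 : ℝ) ^ ((((3 : ℕ) : ℤ) - 2) * ((n + 1 : ℕ) : ℤ)) := by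
  rw [curveJetBar_of_one_le (show 1 ≤ 3 by norm_num), klC1AnFit'_of_ne_zero cc cc' (by norm_num), klC1AnFit_three, klC1AnFit_three]
  ring

/-- Row `4`. -/
theorem curveJetBar_klC1AnFit_four : curveJetBar (klC1AnFit cc) (klC1AnFit' cc cc') U 4 (n + 1) =
    (0.0075 * (cc 1 + cc' 1 * |U|) + 0.000000011 * (cc 2 + cc' 2 * |U|) + 0.00000025 * (cc 3 + cc' 3 * |U|) + 0.12502 * (cc 4 + cc' 4 * |U|)) *
      U ^ 2 * (4 : ℝ) ^ ((((4 : ℕ) : ℤ) - 2) * ((n + 1 : ℕ) : ℤ)) := by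
  rw [curveJetBar_of_one_le (show 1 ≤ 4 by norm_num), klC1AnFit'_of_ne_zero cc cc' (by norm_num), klC1AnFit_four, klC1AnFit_four]
  ring


/-- Row `0` of the UNPRIMED booking (`…CertAnFit`'s `klC1TableAn_value_le₀` form). -/
theorem curveJetBar_klC1AnFit₀_zero (U₀ : ℝ) :
    curveJetBar (fun k => klC1AnFit cc k + if k = 0 then 0.189 * (cc 1 + cc' 1) * U₀ else 0) (klC1AnFit cc') U 0 (n + 1) =
    (0.189 * (cc 1 + cc' 1) * U₀ + 0 * |U|) * |U| * (4 : ℝ) ^ ((((0 : ℕ) : ℤ) - 2) * ((n + 1 : ℕ) : ℤ)) := by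
  rw [curveJetBar_apply, klC1AnFit_zero]
  simp only [uPow, if_true, klC1AnFit_zero]
  ring

/-- Rows `k ≥ 1` of the unprimed booking agree with the primed one. -/
theorem curveJetBar_klC1AnFit₀_of_ne_zero (U₀ : ℝ) {k : ℕ} (hk : k ≠ 0) :
    curveJetBar (fun k => klC1AnFit cc k + if k = 0 then 0.189 * (cc 1 + cc' 1) * U₀ else 0) (klC1AnFit cc') U k (n + 1) =
    curveJetBar (klC1AnFit cc) (klC1AnFit' cc cc') U k (n + 1) := by
  rw [curveJetBar_apply, curveJetBar_apply, klC1AnFit'_of_ne_zero cc cc' hk]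
  simp [hk]

end Currency

/-! ## §2 The flow frame's growth rows are `n`-free small below `klEngU₀9` -/

/-- `A₃·4⁻ⁿ = (4/3)·Gfr₃·U² ≤ 2⁻¹²⁶` and `A₄·16⁻ⁿ = (16/15)·Gfr₄·U² ≤ 2⁻¹²⁶` below `klEngU₀9` (`Gfr_j·U ≤ 2⁻¹²⁷`, `U ≤ 1`). -/
theorem flowFrame_growthRows_small {P : SplitConsts} {R : RenConsts} (hRW : R.WF) {c U : ℝ} (hU : 0 < U) (hU9 : U ≤ klEngU₀9 P R c) (n : ℕ) :
    R.Gfr 3 / 3 * U ^ 2 * 4 ^ (n + 1) * (1 / 4 : ℝ) ^ n ≤ 1 / 2 ^ 126 ∧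
    R.Gfr 4 / 15 * U ^ 2 * 16 ^ (n + 1) * ((1 / 4 : ℝ) ^ n) ^ 2 ≤ 1 / 2 ^ 126 := by
  have hR : ∀ j, 0 ≤ R.Gfr j := hRW.2.2
  have hU4 : U ≤ klEngU₀4 P R c := hU9.trans (klEngU₀9_le_klEngU₀4 P R c)
  have hg3 : R.Gfr 3 * U ≤ 1 / 2 ^ 127 := gfr_mul_le_of_le_klEngU₀4 hRW hU4 (by norm_num)
  have hg4 : R.Gfr 4 * U ≤ 1 / 2 ^ 127 := gfr_mul_le_of_le_klEngU₀4 hRW hU4 (by norm_num)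
  have hU1 : U ≤ 1 := by
    have h' := hU4.trans (klEngU₀4_le_inv_gfr_add_one P hRW c (show 0 < 5 by norm_num))
    have hG0 := hR 0
    exact h'.trans (by rw [div_le_one (by linarith)]; linarith)
  have hG3 := hR 3
  have hG4 := hR 4
  have e3 : (4 : ℝ) ^ (n + 1) * (1 / 4 : ℝ) ^ n = 4 := by
    rw [pow_succ, mul_assoc, mul_comm 4, ← mul_assoc, ← mul_pow]; norm_num
  have e4 : (16 : ℝ) ^ (n + 1) * ((1 / 4 : ℝ) ^ n) ^ 2 = 16 := by
    rw [← pow_mul, mul_comm n 2, pow_mul, pow_succ, mul_assoc, mul_comm 16, ← mul_assoc, ← mul_pow]; norm_num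
  have hUU : U ^ 2 ≤ U := by nlinarith
  constructor
  · calc R.Gfr 3 / 3 * U ^ 2 * 4 ^ (n + 1) * (1 / 4 : ℝ) ^ n = 4 / 3 * (R.Gfr 3 * U ^ 2) := by
          rw [mul_assoc (R.Gfr 3 / 3 * U ^ 2), e3]; ring
      _ ≤ 4 / 3 * (R.Gfr 3 * U) := by gcongr
      _ ≤ 4 / 3 * (1 / 2 ^ 127) := by gcongr
      _ ≤ 1 / 2 ^ 126 := by norm_num
  · calc R.Gfr 4 / 15 * U ^ 2 * 16 ^ (n + 1) * ((1 / 4 : ℝ) ^ n) ^ 2 = 16 / 15 * (R.Gfr 4 * U ^ 2) := by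
          rw [mul_assoc (R.Gfr 4 / 15 * U ^ 2), e4]; ring
      _ ≤ 16 / 15 * (R.Gfr 4 * U) := by gcongr
      _ ≤ 16 / 15 * (1 / 2 ^ 127) := by gcongr
      _ ≤ 1 / 2 ^ 126 := by norm_num

/-! ## §3 The one-call (C1) door in `curveJetBar` currency -/

section Stub

variable {L M : ℕ} [NeZero L] [NeZero M]

/-- **THE (C1) BRACKET IN `readResidue_flow_hP`'s CURRENCY, EVERY READING SCALE `n + 1 ≥ 6`.**  Under stub (C)'s binders, the regime at the
reading scale, the new flow frame admissible, the history's flow-piece jets, the window certificate `KlwjCertA`, `5 ≤ n` and the induction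
hypothesis `TwoLegReadJetBound L M cc cc' β U μ K_n n` (`cc, cc' ≥ 0`): `J = ν_n(K_n) − (klFlowPiece n)∘k_F^{K_{n+1}}` is `C⁴` and
`|∂ᵏJ(θ)| ≤ curveJetBar (klC1AnFit cc) (klC1AnFit' cc cc') U k (n+1)` for `k ≤ 4` and every `θ`. -/
theorem readResidueC1_hJ_analytic_klEng (hT : KlwjCertA) {P : SplitConsts} {R : RenConsts} (hRW : R.WF) {c : ℝ} (hc : 0 < c)
    (hc6 : c ≤ klEngC₃6 P R) {μ : ℝ} (hμ : μ ∈ klWindowC) {U : ℝ} (hU : 0 < U) (hU9 : U ≤ klEngU₀9 P R c) {β : ℝ}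
    (hβmin : klBetaMin ≤ β) (hβc : β ≤ Real.exp (c / U ^ 2)) {n : ℕ} (hn : 5 ≤ n) (hreg : IsKLRegime U c (-((n + 1 : ℕ) : ℤ)))
    (hK : FrameOK R U (nScales β) μ (klFlowFrameU L M β U μ (n + 1))) (hist : ∀ m < n + 1, FlowPieceJetsAt L M β U μ R m)
    {cc cc' : ℕ → ℝ} (hcc : ∀ k, 0 ≤ cc k) (hcc' : ∀ k, 0 ≤ cc' k)
    (hIH : TwoLegReadJetBound L M cc cc' β U μ (klFlowFrameU L M β U μ n) n) :
    ContDiff ℝ 4 (fun θ : ℝ => klLocalPart L M β U μ (klFlowFrameU L M β U μ n) n θ -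
        (klFlowPiece L M β U μ n).eval (klFermiPoint μ (klFlowFrameU L M β U μ (n + 1)) θ)) ∧
    ∀ k ≤ 4, ∀ θ : ℝ, |iteratedDeriv k (fun θ : ℝ => klLocalPart L M β U μ (klFlowFrameU L M β U μ n) n θ -
        (klFlowPiece L M β U μ n).eval (klFermiPoint μ (klFlowFrameU L M β U μ (n + 1)) θ)) θ| ≤
      curveJetBar (klC1AnFit cc) (klC1AnFit' cc cc') U k (n + 1) := by
  have hR : ∀ j, 0 ≤ R.Gfr j := hRW.2.2
  -- the IH's size table, named
  obtain ⟨ha_nn, ha0, ha⟩ := ihSizes_of_twoLegReadJetBound (L := L) (M := M) hcc hcc' hIH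
  set a : ℕ → ℝ := (fun l : ℕ => if l = 0 then π / 2 * curveJetBar cc cc' U 1 n else curveJetBar cc cc' U l n) with ha_def
  have ea0 : a 0 = π / 2 * curveJetBar cc cc' U 1 n := by simp [ha_def]
  have ea : ∀ l, 1 ≤ l → a l = curveJetBar cc cc' U l n := fun l hl => by
    have : l ≠ 0 := by omega
    simp [ha_def, this]
  -- the growth rows' smallness (before naming them)
  obtain ⟨hu, hv⟩ := flowFrame_growthRows_small (P := P) (c := c) hRW hU hU9 n
  -- the analytic certificate's linear forms at the flow frame's size table
  obtain ⟨h1, h2, h3, h4⟩ := readResidueC1_jets_analytic_klEng (L := L) (M := M) hT hRW hc hc6 hμ hU hU9 hβmin hβc hreg hK hist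
    (δ₀ := 31 / 2500) (by norm_num) (by norm_num) (by rw [klFlatR]; norm_num) hIH.contDiff ha_nn ha0 ha
  -- name the data of the fit
  set A₃ : ℝ := R.Gfr 3 / 3 * U ^ 2 * 4 ^ (n + 1) with hA₃
  set A₄ : ℝ := R.Gfr 4 / 15 * U ^ 2 * 16 ^ (n + 1) with hA₄
  have hA3 : 0 ≤ A₃ := by have := hR 3; positivity
  have hA4 : 0 ≤ A₄ := by have := hR 4; positivity
  set D : ℕ → ℝ := (fun i : ℕ => if i = 1 then (4.31 : ℝ) else if i = 2 then 27 else if i = 3 then 297 + 971 * A₃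
    else 8281 + 165600 * A₃ + 8400 * A₄) with hDdef
  have hD : ∀ i, 0 ≤ D i := fun i => by simp only [hDdef]; split_ifs <;> positivity
  have hD1 : D 1 = 4.31 := by simp [hDdef]
  have hD2 : D 2 = 27 := by simp [hDdef]
  have hD3 : D 3 = 297 + 971 * A₃ := by simp [hDdef]
  have hD4 : D 4 = 8281 + 165600 * A₃ + 8400 * A₄ := by simp [hDdef]
  have hU1 : |U| ≤ 1 := by
    have hU4 : U ≤ klEngU₀4 P R c := hU9.trans (klEngU₀9_le_klEngU₀4 P R c)
    have h' := hU4.trans (klEngU₀4_le_inv_gfr_add_one P hRW c (show 0 < 5 by norm_num))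
    have hG0 := hR 0
    rw [abs_of_pos hU]
    exact h'.trans (by rw [div_le_one (by linarith)]; linarith)
  refine ⟨h1, fun k hk θ => ?_⟩
  interval_cases k
  · rw [iteratedDeriv_zero, curveJetBar_klC1AnFit_zero]
    exact (h2 θ).trans (klC1TableAn_value_le n hn hD hcc hcc' hU1 ea0 ea)
  · rw [curveJetBar_klC1AnFit_one]
    exact (h3 1 le_rfl (by norm_num) θ).trans (klC1TableAn_bound_one_le n hn hD hD1 hcc hcc' U ea0 ea)
  · rw [curveJetBar_klC1AnFit_two]
    exact (h3 2 (by norm_num) (by norm_num) θ).trans (klC1TableAn_bound_two_le n hn hD hD1 hD2 hcc hcc' U ea0 ea)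
  · rw [curveJetBar_klC1AnFit_three]
    exact (h3 3 (by norm_num) le_rfl θ).trans (klC1TableAn_bound_three_le n hn hD hD1 hD2 hD3 hA3 hu hcc hcc' U ea0 ea)
  · rw [curveJetBar_klC1AnFit_four]
    exact (h4 4 (by norm_num) le_rfl θ).trans (klC1TableAn_boundNR_four_le n hn hD hD1 hD2 hD3 hD4 hA3 hA4 hu hv hcc hcc' U ea0 ea)

/-- **The same door, UNPRIMED BOOKING of the value row** (`|U| ≤ U₀ ≤ 1`, e.g. `U₀ = klEngU₀9 P R c`): output tables
`(klC1AnFit cc + [k = 0]·0.189·(cc 1 + cc' 1)·U₀, klC1AnFit cc')` — rows `k ≥ 1` identical, the `O(U²)` value of the bracket booked on the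
`|U|`-constant with the factor `U₀` instead of on the `|U|`-suppressed constant.  Original form:  Under stub (C)'s binders, the regime at the
reading scale, the new flow frame admissible, the history's flow-piece jets, the window certificate `KlwjCertA`, `5 ≤ n` and the induction
hypothesis `TwoLegReadJetBound L M cc cc' β U μ K_n n` (`cc, cc' ≥ 0`): `J = ν_n(K_n) − (klFlowPiece n)∘k_F^{K_{n+1}}` is `C⁴` and
`|∂ᵏJ(θ)| ≤ curveJetBar (klC1AnFit cc) (klC1AnFit' cc cc') U k (n+1)` for `k ≤ 4` and every `θ`. -/
theorem readResidueC1_hJ_analytic_klEng₀ (hT : KlwjCertA) {P : SplitConsts} {R : RenConsts} (hRW : R.WF) {c : ℝ} (hc : 0 < c)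
    (hc6 : c ≤ klEngC₃6 P R) {μ : ℝ} (hμ : μ ∈ klWindowC) {U : ℝ} (hU : 0 < U) (hU9 : U ≤ klEngU₀9 P R c) {β : ℝ}
    (hβmin : klBetaMin ≤ β) (hβc : β ≤ Real.exp (c / U ^ 2)) {n : ℕ} (hn : 5 ≤ n) (hreg : IsKLRegime U c (-((n + 1 : ℕ) : ℤ)))
    (hK : FrameOK R U (nScales β) μ (klFlowFrameU L M β U μ (n + 1))) (hist : ∀ m < n + 1, FlowPieceJetsAt L M β U μ R m)
    {cc cc' : ℕ → ℝ} (hcc : ∀ k, 0 ≤ cc k) (hcc' : ∀ k, 0 ≤ cc' k)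
    (hIH : TwoLegReadJetBound L M cc cc' β U μ (klFlowFrameU L M β U μ n) n) {U₀ : ℝ} (hU0 : U ≤ U₀) (hU01 : U₀ ≤ 1) :
    ContDiff ℝ 4 (fun θ : ℝ => klLocalPart L M β U μ (klFlowFrameU L M β U μ n) n θ -
        (klFlowPiece L M β U μ n).eval (klFermiPoint μ (klFlowFrameU L M β U μ (n + 1)) θ)) ∧
    ∀ k ≤ 4, ∀ θ : ℝ, |iteratedDeriv k (fun θ : ℝ => klLocalPart L M β U μ (klFlowFrameU L M β U μ n) n θ -
        (klFlowPiece L M β U μ n).eval (klFermiPoint μ (klFlowFrameU L M β U μ (n + 1)) θ)) θ| ≤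
      curveJetBar (fun k => klC1AnFit cc k + if k = 0 then 0.189 * (cc 1 + cc' 1) * U₀ else 0) (klC1AnFit cc') U k (n + 1) := by
  have hR : ∀ j, 0 ≤ R.Gfr j := hRW.2.2
  -- the IH's size table, named
  obtain ⟨ha_nn, ha0, ha⟩ := ihSizes_of_twoLegReadJetBound (L := L) (M := M) hcc hcc' hIH
  set a : ℕ → ℝ := (fun l : ℕ => if l = 0 then π / 2 * curveJetBar cc cc' U 1 n else curveJetBar cc cc' U l n) with ha_def
  have ea0 : a 0 = π / 2 * curveJetBar cc cc' U 1 n := by simp [ha_def]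
  have ea : ∀ l, 1 ≤ l → a l = curveJetBar cc cc' U l n := fun l hl => by
    have : l ≠ 0 := by omega
    simp [ha_def, this]
  -- the growth rows' smallness (before naming them)
  obtain ⟨hu, hv⟩ := flowFrame_growthRows_small (P := P) (c := c) hRW hU hU9 n
  -- the analytic certificate's linear forms at the flow frame's size table
  obtain ⟨h1, h2, h3, h4⟩ := readResidueC1_jets_analytic_klEng (L := L) (M := M) hT hRW hc hc6 hμ hU hU9 hβmin hβc hreg hK hist
    (δ₀ := 31 / 2500) (by norm_num) (by norm_num) (by rw [klFlatR]; norm_num) hIH.contDiff ha_nn ha0 ha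
  -- name the data of the fit
  set A₃ : ℝ := R.Gfr 3 / 3 * U ^ 2 * 4 ^ (n + 1) with hA₃
  set A₄ : ℝ := R.Gfr 4 / 15 * U ^ 2 * 16 ^ (n + 1) with hA₄
  have hA3 : 0 ≤ A₃ := by have := hR 3; positivity
  have hA4 : 0 ≤ A₄ := by have := hR 4; positivity
  set D : ℕ → ℝ := (fun i : ℕ => if i = 1 then (4.31 : ℝ) else if i = 2 then 27 else if i = 3 then 297 + 971 * A₃
    else 8281 + 165600 * A₃ + 8400 * A₄) with hDdef
  have hD : ∀ i, 0 ≤ D i := fun i => by simp only [hDdef]; split_ifs <;> positivity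
  have hD1 : D 1 = 4.31 := by simp [hDdef]
  have hD2 : D 2 = 27 := by simp [hDdef]
  have hD3 : D 3 = 297 + 971 * A₃ := by simp [hDdef]
  have hD4 : D 4 = 8281 + 165600 * A₃ + 8400 * A₄ := by simp [hDdef]
  refine ⟨h1, fun k hk θ => ?_⟩
  have hU0' : |U| ≤ U₀ := by rwa [abs_of_pos hU]
  interval_cases k
  · rw [iteratedDeriv_zero, curveJetBar_klC1AnFit₀_zero]
    exact (h2 θ).trans (klC1TableAn_value_le₀ n hn hD hcc hcc' hU0' hU01 ea0 ea)
  · rw [curveJetBar_klC1AnFit₀_of_ne_zero cc cc' U n U₀ one_ne_zero, curveJetBar_klC1AnFit_one]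
    exact (h3 1 le_rfl (by norm_num) θ).trans (klC1TableAn_bound_one_le n hn hD hD1 hcc hcc' U ea0 ea)
  · rw [curveJetBar_klC1AnFit₀_of_ne_zero cc cc' U n U₀ (by norm_num), curveJetBar_klC1AnFit_two]
    exact (h3 2 (by norm_num) (by norm_num) θ).trans (klC1TableAn_bound_two_le n hn hD hD1 hD2 hcc hcc' U ea0 ea)
  · rw [curveJetBar_klC1AnFit₀_of_ne_zero cc cc' U n U₀ (by norm_num), curveJetBar_klC1AnFit_three]
    exact (h3 3 (by norm_num) le_rfl θ).trans (klC1TableAn_bound_three_le n hn hD hD1 hD2 hD3 hA3 hu hcc hcc' U ea0 ea)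
  · rw [curveJetBar_klC1AnFit₀_of_ne_zero cc cc' U n U₀ (by norm_num), curveJetBar_klC1AnFit_four]
    exact (h4 4 (by norm_num) le_rfl θ).trans (klC1TableAn_boundNR_four_le n hn hD hD1 hD2 hD3 hD4 hA3 hA4 hu hv hcc hcc' U ea0 ea)

end Stub

/-! ## §4 The matrix at the REGISTERED history table `klC4aJetC2 = (2¹⁰, 2¹⁰, 2⁴, 2⁴, 2¹¹)` (stub (C)'s conclusion table) -/

/-- `klC1AnFit klC4aJetC2 = (0, 0.996864, 0.1969344, 7.04585712, 263.720964176)`: the (C1) bracket's share of `klC4aJetC2 k` at every deep reading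
scale is `≤ (0.00098, 0.0124, 0.4404, 0.1288)` for `k = 1 … 4` — row 3 is the located pinch (the rate entry `κ/4·cc 4` with `cc 4/cc 3 = 128`). -/
theorem klC1AnFit_klC4aJetC2_le :
    klC1AnFit klC4aJetC2 1 ≤ 0.00098 * klC4aJetC2 1 ∧ klC1AnFit klC4aJetC2 2 ≤ 0.0124 * klC4aJetC2 2 ∧
    klC1AnFit klC4aJetC2 3 ≤ 0.4404 * klC4aJetC2 3 ∧ klC1AnFit klC4aJetC2 4 ≤ 0.1288 * klC4aJetC2 4 := by
  refine ⟨?_, ?_, ?_, ?_⟩ <;> norm_num [klC1AnFit_one, klC1AnFit_two, klC1AnFit_three, klC1AnFit_four, klC4aJetC2]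

end Summit.HubbardSuperconductivity.HubbardSuperconductivity.Theorems.KLRegimeSplit

end
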